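import Summits.ResolutionOfSingularities.ResolutionOfSingularities.Theorems.EquisingularLiftEquisingularLiftNatResidueHypDefs5
import Summits.ResolutionOfSingularities.ResolutionOfSingularities.Theorems.EquisingularLiftEquisingularLiftNatNoseResidueTopLocus
import Literature.AlgebraicGeometry.Resolution.AlterationsNormalFormStrictTransform
import HarnessLib

/-!
# [OURS · L1 W4.5(b) · EL♮(3)] NOSE RESIDUE STRUCTURE, brick 10 — the two NEW nose hypotheses of NOSE WORD v1.1 (ν1 `NoseHypUnobsBTriplePrime`,
# ν2 `NoseHypPointsFirstBTriplePrime`, (N0) ✓ `…NatResidueHypDefs5`) UNFOLDED; the ambient-regularity clause of ν1 is automatic at the initial stage;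
# the profile of `¬ν1` at the singular curves of a residue `H ⊂ ℙ³_k`

Cell `res-hironaka`, rung L, slot W4.5(b), D-0157 DOOR 1 width seat `res-L1-w45b-nose-w4` (RULINGS R33 (δ) / R35: the 36th = the nose cut registering
`¬ NoseHypUnobsBTriplePrime → ¬ NoseHypPointsFirstBTriplePrime` beside the core {¬LC₂, ¬B″, ¬B‴} once the rungs close); crux CHILD EL♮(3) =
stmt-ResolutionOfSingularities-20148. OURS; NOT a statement of any manuscript; nothing of [Hironaka2017] is asserted or used; AI kernel work, weaker than expert
review. Resolution of singularities in positive characteristic is NOT proved here (dimension 3 is a theorem in print, Cossart–Piltant 2008/2009). No `sorry`, no new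
definition, no instance, no notation; standard axioms. `--kind proof --supports stmt-ResolutionOfSingularities-20148 --as helper`.  Sister files: bricks 1–10a.

* §1 `not_noseHypUnobsBTriplePrime_iff` / `not_noseHypPointsFirstBTriplePrime_iff` — the curried negations (pattern of brick 1a): what `H` satisfies when it ESCAPES
  ν1 («for every closed `Z ⊊ ι(H)` with REGULAR reduced curve, ambient regular along it, `H¹(𝒩) = 0` (`DirStepUnobs`), infinite, one-dimensional local rings:
  every B‴ chain from `Bl_Z` ends non-regular») resp. ν2 («every stage reached by point steps and by nose moves `ReachPtNoseBTriplePrime` hung off a point step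
  has a non-regular reduced strict transform»).
* §2 `isRegularLocalRing_redSub_univ_of_isRegular` / `noseHypUnobsBTriplePrime_iff_of_ambient` — in the initial-stage blob ν1 the clause «`ℙⁿ_k` regular along `Z̃`»
  (`∀ i, i ≫ redSubι univ = redSubι Z → ∀ x, IsRegularLocalRing 𝒪_{(ℙⁿ)~_red, i x}`) is AUTOMATIC (`isRegular_projectiveSpace` transported to `redSub ℙⁿ univ` by
  Literature `isRegular_subscheme_vanishingIdeal_range (𝟙 _)`): `ν1 ↔ ν1 without that clause`.  (It is there for stage-genericity of the `Reach` slot; no cost.)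
* §3 ★ `nose_residue_profile_nu1_three` — under `¬ NoseHypUnobsBTriplePrime k 3 H ι`, for EVERY closed irreducible infinite `Z ⊆ ι(H)` with `ι(H) ⊄ Z` of a
  non-regular integral `H ↪ ℙ³_k` whose reduced curve `Z̃` is REGULAR with `DirStepUnobs ℙ³ univ _ Z hZ` (`H¹(𝒩) = 0`): from every blow-up of `Z`, every B‴ chain
  ends NON-regular (curve clause by brick 2, ambient clause by §2) — «persistence along smooth UNOBSTRUCTED curves», the ν1-analogue of brick 4.
  No formal implication between ν1, ν2 and B‴ is claimed (NOSE WORD v1.1 (K-ν-5); a class₂ curve need not have `H¹(𝒩) = 0`, an unobstructed curve need not be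
  class₂, and ν2's nose move hangs off a point step).
-/

set_option linter.dupNamespace false

noncomputable section

open CategoryTheory CategoryTheory.Limits AlgebraicGeometry TopologicalSpace Topology IsLocalRing
open Literature.AlgebraicGeometry.Resolution
open Literature.AlgebraicGeometry.Motives
open AlgebraicGeometry.Scheme.IdealSheafData
open Summit.ResolutionOfSingularities.ResolutionOfSingularities.Cruxes.EquisingularLift.StrataSplit

namespace Summit.ResolutionOfSingularities.ResolutionOfSingularities.Cruxes.EquisingularLiftNat.Sections

/-! ## §1 The two new nose hypotheses, unfolded -/

/-- **`¬ NoseHypUnobsBTriplePrime`, unfolded** (ν1 of NOSE WORD v1.1): `H` escapes the unobstructed B‴ nose iff for every closed `Z ⊊ ι(H)` whose reduced curve is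
regular, with the ambient regular along it and `DirStepUnobs ℙⁿ univ _ Z hZ` (`H¹(𝒩) = 0`), infinite with one-dimensional local rings at closed points, every blow-up
`υ` of `Z` and every B‴ chain from the seed end with a NON-regular reduced strict transform. [OURS · L1 W4.5b · pure logic] -/
theorem not_noseHypUnobsBTriplePrime_iff (k : Type) [Field k] (n : ℕ) (H : Scheme.{0})
    (ι : H ⟶ (Literature.AlgebraicGeometry.Motives.projectiveSpace n k).left) :
    ¬ NoseHypUnobsBTriplePrime k n H ι ↔
      ∀ (Z : Set (Literature.AlgebraicGeometry.Motives.projectiveSpace n k).left) (hZ : IsClosed Z),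
        (∀ x : redSub (Literature.AlgebraicGeometry.Motives.projectiveSpace n k).left Z hZ,
          IsRegularLocalRing ((redSub (Literature.AlgebraicGeometry.Motives.projectiveSpace n k).left Z hZ).presheaf.stalk x)) →
        (∀ (i : redSub (Literature.AlgebraicGeometry.Motives.projectiveSpace n k).left Z hZ ⟶
            redSub (Literature.AlgebraicGeometry.Motives.projectiveSpace n k).left Set.univ isClosed_univ),
          i ≫ redSubι (Literature.AlgebraicGeometry.Motives.projectiveSpace n k).left Set.univ isClosed_univ =
            redSubι (Literature.AlgebraicGeometry.Motives.projectiveSpace n k).left Z hZ →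
          ∀ x : redSub (Literature.AlgebraicGeometry.Motives.projectiveSpace n k).left Z hZ,
            IsRegularLocalRing ((redSub (Literature.AlgebraicGeometry.Motives.projectiveSpace n k).left Set.univ isClosed_univ).presheaf.stalk (i x))) →
        DirStepUnobs (Literature.AlgebraicGeometry.Motives.projectiveSpace n k).left Set.univ isClosed_univ Z hZ →
        Z ⊆ Set.range ι → ¬ (Set.range ι ⊆ Z) → Z.Infinite →
        (∀ z : ↥(redSub (Literature.AlgebraicGeometry.Motives.projectiveSpace n k).left Z hZ),
          IsClosed ({z} : Set ↥(redSub (Literature.AlgebraicGeometry.Motives.projectiveSpace n k).left Z hZ)) →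
            ringKrullDim ((redSub (Literature.AlgebraicGeometry.Motives.projectiveSpace n k).left Z hZ).presheaf.stalk z) =
              ((1 : ℕ) : WithBot ℕ∞)) →
        ∀ (F₂ : Scheme.{0}) (υ : F₂ ⟶ (Literature.AlgebraicGeometry.Motives.projectiveSpace n k).left),
          IsBlowup υ (Scheme.IdealSheafData.vanishingIdeal
            (⟨Z, hZ⟩ : Closeds (Literature.AlgebraicGeometry.Motives.projectiveSpace n k).left)) →
          ∀ (F' : Scheme.{0}) (γ' : F' ⟶ F₂) (T' E' : Set F') (Es' Ns' : List (Set F')) (K' : Set F'),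
            (∀ R : (∀ G : Scheme.{0}, (G ⟶ F₂) → Set G → Set G → List (Set G) → List (Set G) → Set G → Prop),
              R F₂ (𝟙 F₂) (closure (υ ⁻¹' (Set.range ι \ Z))) (υ ⁻¹' Z) [] [] ∅ →
              TowerPtRegB₄ F₂ R →
              TowerPtRamB₄ F₂ R →
              TowerRoundBTriplePrime (Literature.AlgebraicGeometry.Motives.projectiveSpace n k).left F₂ υ Z hZ R →
              R F' γ' T' E' Es' Ns' K') →
            ¬ Literature.AlgebraicGeometry.Resolution.Scheme.IsRegular (redSub F' (closure T') isClosed_closure) := by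
  constructor
  · intro h Z hZ h1 h2 h3 h4 h5 h6 h7 F₂ υ hυ F' γ' T' E' Es' Ns' K' hcl hreg
    exact h ⟨Z, hZ, h1, h2, h3, h4, h5, h6, h7, F₂, υ, hυ, F', γ', T', E', Es', Ns', K', hcl, hreg⟩
  · rintro h ⟨Z, hZ, h1, h2, h3, h4, h5, h6, h7, F₂, υ, hυ, F', γ', T', E', Es', Ns', K', hcl, hreg⟩
    exact h Z hZ h1 h2 h3 h4 h5 h6 h7 F₂ υ hυ F' γ' T' E' Es' Ns' K' hcl hreg

/-- **`¬ NoseHypPointsFirstBTriplePrime`, unfolded** (ν2 of NOSE WORD v1.1, «points first, then an unobstructed nose, then B‴»): `H` escapes ν2 iff every stage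
`(F', ρ', T')` reached from `(ℙⁿ_k, 𝟙, ι(H))` by the chains' point steps and by nose moves `ReachPtNoseBTriplePrime` hung off a point step has a NON-regular reduced
strict transform `closure T'`. [OURS · L1 W4.5b · pure logic] -/
theorem not_noseHypPointsFirstBTriplePrime_iff (k : Type) [Field k] [IsAlgClosed k] (n : ℕ) (H : Scheme.{0})
    (ι : H ⟶ (Literature.AlgebraicGeometry.Motives.projectiveSpace n k).left) :
    ¬ NoseHypPointsFirstBTriplePrime k n H ι ↔
      ∀ (F' : Scheme.{0}) (ρ' : F' ⟶ (Literature.AlgebraicGeometry.Motives.projectiveSpace n k).left) (T' : Set F'),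
        (∀ Q : (∀ F₁ : Scheme.{0}, (F₁ ⟶ (Literature.AlgebraicGeometry.Motives.projectiveSpace n k).left) → Set F₁ → Prop),
          Q (Literature.AlgebraicGeometry.Motives.projectiveSpace n k).left (𝟙 _) (Set.range ι) →
          (∀ (F₁ F₂ : Scheme.{0}) (ρ : F₁ ⟶ (Literature.AlgebraicGeometry.Motives.projectiveSpace n k).left) (T₁ : Set F₁)
              (x : ↥(vanishingIdeal (⟨closure T₁, isClosed_closure⟩ : Closeds F₁)).subscheme) (υ : F₂ ⟶ F₁)
              (hx : IsClosed ({((vanishingIdeal (⟨closure T₁, isClosed_closure⟩ : Closeds F₁)).subschemeι x : F₁)} : Set F₁)),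
            Q F₁ ρ T₁ →
            ¬ IsRegularLocalRing ((vanishingIdeal (⟨closure T₁, isClosed_closure⟩ : Closeds F₁)).subscheme.presheaf.stalk x) →
            IsRegularLocalRing (F₁.presheaf.stalk ((vanishingIdeal (⟨closure T₁, isClosed_closure⟩ : Closeds F₁)).subschemeι x)) →
            IsBlowup υ (vanishingIdeal
              (⟨{((vanishingIdeal (⟨closure T₁, isClosed_closure⟩ : Closeds F₁)).subschemeι x : F₁)}, hx⟩ : Closeds F₁)) →
            Q F₂ (υ ≫ ρ) (closure (υ ⁻¹' (T₁ \ {((vanishingIdeal (⟨closure T₁, isClosed_closure⟩ : Closeds F₁)).subschemeι x : F₁)}))) ∧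
            (∀ (F₉ : Scheme.{0}) (β : F₉ ⟶ F₂) (T₉ : Set F₉),
              ReachPtNoseBTriplePrime F₁ F₂ υ ((vanishingIdeal (⟨closure T₁, isClosed_closure⟩ : Closeds F₁)).subschemeι x)
                (closure (υ ⁻¹' (T₁ \ {((vanishingIdeal (⟨closure T₁, isClosed_closure⟩ : Closeds F₁)).subschemeι x : F₁)}))) F₉ β T₉ →
              Q F₉ ((β ≫ υ) ≫ ρ) T₉)) →
          Q F' ρ' T') →
        ¬ Literature.AlgebraicGeometry.Resolution.Scheme.IsRegular
            (vanishingIdeal (⟨closure T', isClosed_closure⟩ : Closeds F')).subscheme := by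
  constructor
  · intro h F' ρ' T' hcl hreg
    exact h ⟨F', ρ', T', hcl, hreg⟩
  · rintro h ⟨F', ρ', T', hcl, hreg⟩
    exact h F' ρ' T' hcl hreg

/-! ## §2 At the initial stage the ambient-regularity clause of ν1 is automatic -/

/-- **`ℙⁿ_k` is regular along every reduced closed subscheme**: for a REGULAR scheme `P`, the reduced subscheme `redSub P univ` is regular at every point in the
image of any `i : Z̃ ⟶ redSub P univ` (indeed everywhere: `redSub P univ ≅ P` for reduced `P`, Literature `isRegular_subscheme_vanishingIdeal_range (𝟙 P)`).
[folklore] -/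
theorem isRegularLocalRing_redSub_univ_of_isRegular {P : Scheme.{0}} (hP : Literature.AlgebraicGeometry.Resolution.Scheme.IsRegular P)
    (y : ↥(redSub P Set.univ isClosed_univ)) : IsRegularLocalRing ((redSub P Set.univ isClosed_univ).presheaf.stalk y) := by
  have hr : (⟨Set.range (𝟙 P : P ⟶ P), (𝟙 P : P ⟶ P).isClosedEmbedding.isClosed_range⟩ : Closeds P) = ⟨Set.univ, isClosed_univ⟩ :=
    Closeds.ext (Set.range_eq_univ.mpr fun x => ⟨x, rfl⟩)
  have h := isRegular_subscheme_vanishingIdeal_range (𝟙 P) hP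
  rw [hr] at h
  exact h y

/-- **ν1 without its ambient clause.** At the initial stage `ℙⁿ_k` the clause «ambient regular along `Z̃`» of `NoseHypUnobsBTriplePrime` holds for free, so ν1 is
equivalent to the same blob with that clause deleted. [OURS · L1 W4.5b · pure logic + `isRegular_projectiveSpace`] -/
theorem noseHypUnobsBTriplePrime_iff_of_ambient (k : Type) [Field k] (n : ℕ) (H : Scheme.{0})
    (ι : H ⟶ (Literature.AlgebraicGeometry.Motives.projectiveSpace n k).left) :
    NoseHypUnobsBTriplePrime k n H ι ↔
      ∃ (Z : Set (Literature.AlgebraicGeometry.Motives.projectiveSpace n k).left) (hZ : IsClosed Z),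
        (∀ x : redSub (Literature.AlgebraicGeometry.Motives.projectiveSpace n k).left Z hZ,
          IsRegularLocalRing ((redSub (Literature.AlgebraicGeometry.Motives.projectiveSpace n k).left Z hZ).presheaf.stalk x)) ∧
        DirStepUnobs (Literature.AlgebraicGeometry.Motives.projectiveSpace n k).left Set.univ isClosed_univ Z hZ ∧
        Z ⊆ Set.range ι ∧ ¬ (Set.range ι ⊆ Z) ∧ Z.Infinite ∧
        (∀ z : ↥(redSub (Literature.AlgebraicGeometry.Motives.projectiveSpace n k).left Z hZ),
          IsClosed ({z} : Set ↥(redSub (Literature.AlgebraicGeometry.Motives.projectiveSpace n k).left Z hZ)) →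
            ringKrullDim ((redSub (Literature.AlgebraicGeometry.Motives.projectiveSpace n k).left Z hZ).presheaf.stalk z) =
              ((1 : ℕ) : WithBot ℕ∞)) ∧
        ∃ (F₂ : Scheme.{0}) (υ : F₂ ⟶ (Literature.AlgebraicGeometry.Motives.projectiveSpace n k).left),
          IsBlowup υ (Scheme.IdealSheafData.vanishingIdeal
            (⟨Z, hZ⟩ : Closeds (Literature.AlgebraicGeometry.Motives.projectiveSpace n k).left)) ∧
          ∃ (F' : Scheme.{0}) (γ' : F' ⟶ F₂) (T' E' : Set F') (Es' Ns' : List (Set F')) (K' : Set F'),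
            (∀ R : (∀ G : Scheme.{0}, (G ⟶ F₂) → Set G → Set G → List (Set G) → List (Set G) → Set G → Prop),
              R F₂ (𝟙 F₂) (closure (υ ⁻¹' (Set.range ι \ Z))) (υ ⁻¹' Z) [] [] ∅ →
              TowerPtRegB₄ F₂ R →
              TowerPtRamB₄ F₂ R →
              TowerRoundBTriplePrime (Literature.AlgebraicGeometry.Motives.projectiveSpace n k).left F₂ υ Z hZ R →
              R F' γ' T' E' Es' Ns' K') ∧
            Literature.AlgebraicGeometry.Resolution.Scheme.IsRegular (redSub F' (closure T') isClosed_closure) := by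
  constructor
  · rintro ⟨Z, hZ, h1, -, h3, h4, h5, h6, h7, F₂, υ, hυ, F', γ', T', E', Es', Ns', K', hcl, hreg⟩
    exact ⟨Z, hZ, h1, h3, h4, h5, h6, h7, F₂, υ, hυ, F', γ', T', E', Es', Ns', K', hcl, hreg⟩
  · rintro ⟨Z, hZ, h1, h3, h4, h5, h6, h7, F₂, υ, hυ, F', γ', T', E', Es', Ns', K', hcl, hreg⟩
    exact ⟨Z, hZ, h1, fun i _ x => isRegularLocalRing_redSub_univ_of_isRegular (isRegular_projectiveSpace n k) (i x), h3, h4, h5, h6, h7,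
      F₂, υ, hυ, F', γ', T', E', Es', Ns', K', hcl, hreg⟩

/-! ## §3 The profile of `¬ν1` at the smooth unobstructed curves of a residue `H ⊂ ℙ³_k` -/

/-- **PERSISTENCE ALONG SMOOTH UNOBSTRUCTED CURVES.** Under `¬ NoseHypUnobsBTriplePrime k 3 H ι`, for a non-regular integral `ι : H ↪ ℙ³_k` and EVERY closed
irreducible infinite `Z ⊆ ι(H)` with `ι(H) ⊄ Z` whose reduced curve `Z̃` is REGULAR and UNOBSTRUCTED (`DirStepUnobs ℙ³ univ _ Z hZ`, `H¹(𝒩) = 0`): from every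
blow-up `υ` of `Z`, every B‴ chain (`TowerPtRegB₄` / `TowerPtRamB₄` / `TowerRoundBTriplePrime`) ends with a NON-regular reduced strict transform.  (Curve clause by
brick 2 `ringKrullDim_stalk_redSub_eq_one`; ambient clause by §2.) [OURS · L1 W4.5b · pure logic over bricks 2/10] -/
theorem nose_residue_profile_nu1_three (k : Type) [Field k] (H : Scheme.{0}) (ι : H ⟶ (projectiveSpace 3 k).left)
    [IsClosedImmersion ι] [IsIntegral H] (hH : ¬ Literature.AlgebraicGeometry.Resolution.Scheme.IsRegular H)
    (hν1 : ¬ NoseHypUnobsBTriplePrime k 3 H ι)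
    (Z : Set (projectiveSpace 3 k).left) (hZ : IsClosed Z) (hZirr : IsIrreducible Z) (hZinf : Z.Infinite) (hZsub : Z ⊆ Set.range ι)
    (hZne : ¬ (Set.range ι ⊆ Z))
    (hreg : ∀ x : redSub (projectiveSpace 3 k).left Z hZ, IsRegularLocalRing ((redSub (projectiveSpace 3 k).left Z hZ).presheaf.stalk x))
    (hunobs : DirStepUnobs (projectiveSpace 3 k).left Set.univ isClosed_univ Z hZ) :
    ∀ (F₂ : Scheme.{0}) (υ : F₂ ⟶ (projectiveSpace 3 k).left),
      IsBlowup υ (vanishingIdeal (⟨Z, hZ⟩ : Closeds (projectiveSpace 3 k).left)) →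
      ∀ (F' : Scheme.{0}) (γ' : F' ⟶ F₂) (T' E' : Set F') (Es' Ns' : List (Set F')) (K' : Set F'),
        (∀ R : (∀ G : Scheme.{0}, (G ⟶ F₂) → Set G → Set G → List (Set G) → List (Set G) → Set G → Prop),
          R F₂ (𝟙 F₂) (closure (υ ⁻¹' (Set.range ι \ Z))) (υ ⁻¹' Z) [] [] ∅ →
          TowerPtRegB₄ F₂ R →
          TowerPtRamB₄ F₂ R →
          TowerRoundBTriplePrime (projectiveSpace 3 k).left F₂ υ Z hZ R →
          R F' γ' T' E' Es' Ns' K') →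
        ¬ Literature.AlgebraicGeometry.Resolution.Scheme.IsRegular (redSub F' (closure T') isClosed_closure) := by
  have hcurve := ringKrullDim_stalk_redSub_eq_one k H ι hH hZ hZirr hZinf hZsub hZne
  have hamb : ∀ (i : redSub (projectiveSpace 3 k).left Z hZ ⟶ redSub (projectiveSpace 3 k).left Set.univ isClosed_univ),
      i ≫ redSubι (projectiveSpace 3 k).left Set.univ isClosed_univ = redSubι (projectiveSpace 3 k).left Z hZ →
      ∀ x : redSub (projectiveSpace 3 k).left Z hZ,
        IsRegularLocalRing ((redSub (projectiveSpace 3 k).left Set.univ isClosed_univ).presheaf.stalk (i x)) :=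
    fun i _ x => isRegularLocalRing_redSub_univ_of_isRegular (isRegular_projectiveSpace 3 k) (i x)
  intro F₂ υ hυ F' γ' T' E' Es' Ns' K' hcl
  exact (not_noseHypUnobsBTriplePrime_iff k 3 H ι).mp hν1 Z hZ hreg hamb hunobs hZsub hZne hZinf hcurve F₂ υ hυ F' γ' T' E' Es' Ns' K' hcl

end Summit.ResolutionOfSingularities.ResolutionOfSingularities.Cruxes.EquisingularLiftNat.Sections

end
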